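import Summits.HodgeConjecture.HodgeCM.PerL34.RestrictedMeasure_2

/-! PORT of `HodgeCM/PerL34/RestrictedMeasure.lean` (HodgeCMPerL run 82) — part 3: continuation of `Summits.HodgeConjecture.HodgeCM.PerL34.RestrictedMeasure_2` (split at a top-level declaration boundary by port_pkg.py; scope re-opened below; declarations unchanged). -/

-- port_pkg: scope re-opened for this part (file-level context, then the namespace/section stack open at the cut)
set_option autoImplicit false
noncomputable section
open MeasureTheory Filter Set Function
open scoped Classical ENNReal
namespace HodgeCM.PerL34.RestrictedMeasure
universe u v
variable {ι : Type u} {G : ι → Type v} [∀ i, MeasurableSpace (G i)]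
variable (K : ∀ i, Set (G i)) (ν : ∀ i, Measure (G i))
section restricted
open scoped RestrictedProduct
variable (hKne : ∀ i, (K i).Nonempty)
variable [Countable ι]
variable [∀ i, SigmaFinite (ν i)]

/-- **The restricted product measure on `A_S` is the product measure** (Tate, Thm 3.3.1; Leahy,
Prop 3.1.8 — existence half, as a theorem): for `S ⊇ S₀`,
`μ|_{A_S} = (e_S)_* ((∏_{i∈S} ν_i) ⊗ ρ_S)`. -/
theorem rpMeasure_restrict_rpBox (hKm : ∀ i, MeasurableSet (K i)) {S₀ : Finset ι}
    (hK1 : ∀ i, i ∉ S₀ → ν i (K i) = 1) {S : Finset ι} (hS : S₀ ⊆ S) :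
    (rpMeasure K ν S₀).restrict (rpBox K S) =
      Measure.map (glue K S) ((Measure.pi fun i : {i // i ∈ S} => ν i).prod (rho K ν hKne S)) := by
  have hemb := measurableEmbedding_incl K hKm
  haveI : ∀ i : {i // i ∉ S}, IsProbabilityMeasure (kap K ν hKne i) :=
    fun i => isProbabilityMeasure_kap K ν hKne hKm i
  haveI := isProbabilityMeasure_rho K ν hKne hKm S
  rw [← hemb.comap_map ((rpMeasure K ν S₀).restrict (rpBox K S)),
    ← hemb.comap_map (Measure.map (glue K S) _)]
  congr 1
  rw [rpBox_eq, rpMeasure, ← hemb.restrict_map, hemb.map_comap,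
    Measure.restrict_restrict (measurableSet_box K hKm S),
    Set.inter_eq_left.2 (box_subset_range_incl K S), glued_restrict_box K ν S₀ hKm hK1 hS,
    Measure.map_map hemb.measurable (measurable_glue K hKm S), incl_comp_glue,
    ← Measure.map_map (measurable_split_symm S) (measurable_id.prodMap (measurable_valPi K S)),
    ← Measure.map_prod_map _ _ measurable_id (measurable_valPi K S), Measure.map_id, rho,
    Measure.infinitePi_map_pi (fun i : {i // i ∉ S} => kap K ν hKne i) (f := fun i => Subtype.val)
      (fun i => measurable_subtype_coe)]
  have hfam : (fun i : {i // i ∉ S} => (kap K ν hKne i).map Subtype.val) =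
      fun i : {i // i ∉ S} => locK K ν i :=
    funext fun i => map_val_kap K ν hKne (hKm i) (hK1 i fun h' => i.2 (hS h'))
  rw [hfam]
  rfl

/-- The level-free form: `μ|_{A_S}` pushed to `Π i, G i` is the level-`S` measure `λ_S`. -/
theorem map_incl_rpMeasure_restrict (hKm : ∀ i, MeasurableSet (K i)) {S₀ : Finset ι}
    (hK1 : ∀ i, i ∉ S₀ → ν i (K i) = 1) {S : Finset ι} (hS : S₀ ⊆ S) :
    ((rpMeasure K ν S₀).restrict (rpBox K S)).map (incl K) = level K ν S := by
  have hemb := measurableEmbedding_incl K hKm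
  rw [rpBox_eq, rpMeasure, ← hemb.restrict_map, hemb.map_comap,
    Measure.restrict_restrict (measurableSet_box K hKm S),
    Set.inter_eq_left.2 (box_subset_range_incl K S), glued_restrict_box K ν S₀ hKm hK1 hS]

/-! #### Uniqueness and σ-finiteness -/

omit [∀ i, MeasurableSpace (G i)] [Countable ι] [∀ i, SigmaFinite (ν i)] in
/-- The cylinders `A_{S₀ ∪ S}` exhaust the restricted product. -/
theorem iUnion_rpBox_union (S₀ : Finset ι) : (⋃ S : Finset ι, rpBox K (S₀ ∪ S)) = univ :=
  eq_univ_of_forall fun x => by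
    obtain ⟨S, hS⟩ := exists_mem_rpBox K x
    exact mem_iUnion.2 ⟨S, rpBox_mono K Finset.subset_union_right hS⟩

omit [∀ i, SigmaFinite (ν i)] in
/-- **Uniqueness**: a measure on the restricted product is determined by its restrictions to the
cylinders `A_S`, `S ⊇ S₀`. -/
theorem ext_of_restrict_rpBox (S₀ : Finset ι) {μ₁ μ₂ : Measure (Πʳ i, [G i, K i])}
    (h : ∀ S : Finset ι, S₀ ⊆ S → μ₁.restrict (rpBox K S) = μ₂.restrict (rpBox K S)) : μ₁ = μ₂ :=
  (Measure.ext_iff_of_iUnion_eq_univ (iUnion_rpBox_union K S₀)).2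
    fun _ => h _ Finset.subset_union_left

/-- `rpMeasure K ν S₀` is the UNIQUE measure on `Πʳ i, [G i, K i]` whose restriction to every `A_S`,
`S ⊇ S₀`, is the product measure (the uniqueness clause of Leahy Prop. 3.1.8). -/
theorem eq_rpMeasure (hKm : ∀ i, MeasurableSet (K i)) {S₀ : Finset ι}
    (hK1 : ∀ i, i ∉ S₀ → ν i (K i) = 1) (μ' : Measure (Πʳ i, [G i, K i]))
    (h : ∀ S : Finset ι, S₀ ⊆ S → μ'.restrict (rpBox K S) =
      Measure.map (glue K S) ((Measure.pi fun i : {i // i ∈ S} => ν i).prod (rho K ν hKne S))) :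
    μ' = rpMeasure K ν S₀ :=
  ext_of_restrict_rpBox K S₀ fun S hS => by
    rw [h S hS, rpMeasure_restrict_rpBox K ν hKne hKm hK1 hS]

/-- The restricted product measure is σ-finite. -/
theorem sigmaFinite_rpMeasure (hKm : ∀ i, MeasurableSet (K i)) {S₀ : Finset ι}
    (hK1 : ∀ i, i ∉ S₀ → ν i (K i) = 1) : SigmaFinite (rpMeasure K ν S₀) := by
  refine Measure.sigmaFinite_of_countable
    (S := Set.range fun p : Finset ι × ℕ =>
      incl K ⁻¹' spanningBox ν (S₀ ∪ p.1) p.2 ∩ rpBox K (S₀ ∪ p.1))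
    (Set.countable_range _) ?_ ?_
  · rintro _ ⟨⟨S, n⟩, rfl⟩
    dsimp only
    rw [← Measure.restrict_apply' (measurableSet_rpBox K hKm _),
      ← Measure.map_apply (measurable_incl K hKm) (measurableSet_spanningBox ν _ n),
      map_incl_rpMeasure_restrict K ν hKm hK1 Finset.subset_union_left]
    exact (level_spanningBox_ne_top K ν _ (fun i hi => isProbabilityMeasure_locK K ν
      (hK1 i fun h' => hi (Finset.mem_union_left _ h'))) n).lt_top
  · rw [Set.sUnion_range]
    refine eq_univ_of_forall fun x => ?_
    obtain ⟨S, hS⟩ := exists_mem_rpBox K x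
    exact mem_iUnion.2 ⟨(S, (S₀ ∪ S).sup fun i => spanningSetsIndex (ν i) (x i)),
      mem_spanningBox_sup ν (S₀ ∪ S) (incl K x), rpBox_mono K Finset.subset_union_right hS⟩

end restricted

end HodgeCM.PerL34.RestrictedMeasure

-- port_pkg: scope closed for this part
end
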